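import Summits.QuantumFields.YangMills.Theses.FluxSectorLaplace
import Summits.QuantumFields.YangMills.Theorems.FluxSectorLaplaceCoreAnnulus
import Summits.QuantumFields.YangMills.Theorems.FluxSectorLaplaceCoreNumerics
import Summits.QuantumFields.YangMills.Theorems.ToronSmallBallOwnAxisShiftWindowGen
import Summits.QuantumFields.YangMills.Theorems.FluxSectorLaplaceFluxSectorSuppression
import HarnessLib

/-!
# `FluxSectorLaplace.PeriodicCoreRaritySubQuartic` (item stmt-QuantumFields-24080) — PROVED

Route `FluxSectorLaplace` crux K2 (rank 3): PERIODIC-SECTOR TORON CORE RARITY.  With `γc = 2/5`, `a = 1/800`, `L₀ = 1`: for `β ≥ β₀` and every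
`1 ≤ L ≤ β^a` the untwisted seam-sector weight of the slice-`0` core `{polDist U₀ ≤ β^(−2/5)}` in the `2L`-slice zero-flux ring is
`≤ β^(−a) · Z_phys(L, β, 2L)`.

METHOD (seat ym-dw-p1 g17; tree engines of seats g15/g16).  (i) ONE seam-axis sheet shift of angle `θ = β^(−13/40)` (g16's `GAxis` engine,
Jacobian `1`, cost `e^Q ≤ e` on the good event, `FluxSectorLaplaceCoreNumerics.gaxis_core_Q`) maps the core into the CONSTANT-CENTRE ANNULUS
`{|polDist U₀ − √(4 − 4cos θ)| ≤ β^(−2/5), (4/3)θ − 2β^(−2/5) < polDist U₀}` (`FluxSectorLaplaceCoreAnnulus`); (ii) that annulus is an off-core strip of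
the untwisted sector, priced by g15's own-axis translate estimate `OwnAxis.sectorWeight_stripGen_le_rpow_of_numerics` (`⌈64eβ^a⌉` disjoint angular
translates of step `6β^(−2/5)`, floor `σ = c₀/4`): `≤ β^(−a)·Z_phys`; (iii) bad fields by the floor bound: `≤ (β^(−a)/2)·Z_phys`; total
`(e + 1/2)β^(−a) ≤ β^(−a/2)`.

CONSEQUENCE: with K1 `FluxSectorSuppression` ⟨24079⟩ (✓ `fluxSectorSuppression_proof`), S1, S2 and the assembly (✓) every hypothesis of
`FluxSectorLaplace.closes` is now a theorem; the route's leaf `ToronSmallBall.ToronCoreRaritySubQuartic` ⟨23956⟩ follows BY NAME (separate file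
`Theorems/ToronSmallBallToronCoreRaritySubQuartic.lean`).

HONEST FRAMING: fixed-lattice transfer-matrix inequalities on the femto window `L ≤ β^(1/800)`; nothing about infinite volume, the continuum limit or the
Clay Yang–Mills gap — the YM mass gap is NOT proved.  No `sorry`, no new axiom, no new definition.  References: [cite: Luscher1983, §2];
[cite: tHooft1979]; [cite: MontvayMunster1994, (3.145)].
-/

set_option autoImplicit false

noncomputable section

open MeasureTheory Set Function Real
open scoped BigOperators
open Literature.MathematicalPhysics.QuantumLattice
open Literature.MathematicalPhysics.QuantumFieldTheory hiding SU2
open Summit.QuantumFields.YangMills.Theorems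
open Summit.QuantumFields.YangMills.Theorems.FemtoTransferGap
open Summit.QuantumFields.YangMills.Theorems.FemtoTransferGap.TT
open Summit.QuantumFields.YangMills.Theorems.FemtoTransferGap.FlatSheet
open Summit.QuantumFields.YangMills.Theorems.FemtoTransferGap.OwnAxis

namespace Summit.QuantumFields.YangMills.Theorems.FluxSectorLaplace

/-! ## §1 Small real-variable steps (kept out of the main proof so that `linarith` never sees the large numeric hypotheses) -/

/-- The cost amplitude of the seam-axis shift on `n + 1 ≤ 2L` slices is below its `2L`-slice majorant. [folklore] -/
theorem gaxisD_le {θ χ η : ℝ} {L n : ℕ} (hθ0 : 0 ≤ θ) (hχ0 : 0 < χ) (hη0 : 0 ≤ η) (hn2 : n + 1 ≤ 2 * L) :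
    |θ| * (L * ((n + 1 : ℕ) * η) / χ + L * (L * Real.sqrt (η ^ 2)) / χ + 2 * χ) + 2 * (L * (L * Real.sqrt (η ^ 2))) * |θ| + 2 * (n * η) * |θ| ≤
      θ * (2 * (L * (L * η)) / χ + L * (L * η) / χ + 2 * χ) + 2 * (L * (L * η)) * θ + 2 * ((2 * L) * η) * θ := by
  rw [abs_of_nonneg hθ0, Real.sqrt_sq hη0]
  have hn1r : ((n + 1 : ℕ) : ℝ) ≤ 2 * (L : ℝ) := by exact_mod_cast hn2
  have hnr : (n : ℝ) ≤ 2 * (L : ℝ) := by push_cast at hn1r; linarith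
  have hL0 : (0 : ℝ) ≤ L := Nat.cast_nonneg L
  have e1 : (L : ℝ) * ((n + 1 : ℕ) * η) / χ ≤ 2 * (L * (L * η)) / χ := by
    refine div_le_div_of_nonneg_right ?_ hχ0.le
    have h : ((n + 1 : ℕ) : ℝ) * η ≤ 2 * (L : ℝ) * η := mul_le_mul_of_nonneg_right hn1r hη0
    have h' := mul_le_mul_of_nonneg_left h hL0
    linarith
  have e2 : 2 * ((n : ℝ) * η) * θ ≤ 2 * ((2 * (L : ℝ)) * η) * θ := by
    have h : (n : ℝ) * η ≤ (2 * (L : ℝ)) * η := mul_le_mul_of_nonneg_right hnr hη0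
    have h' := mul_le_mul_of_nonneg_right h hθ0
    linarith
  have e3 : θ * ((L : ℝ) * ((n + 1 : ℕ) * η) / χ + L * (L * η) / χ + 2 * χ) ≤ θ * (2 * (L * (L * η)) / χ + L * (L * η) / χ + 2 * χ) :=
    mul_le_mul_of_nonneg_left (by linarith) hθ0
  linarith

/-- The link amplitude likewise. [folklore] -/
theorem gaxisDg_le {θ χ η : ℝ} {L n : ℕ} (hθ0 : 0 ≤ θ) (hη0 : 0 ≤ η) (hn2 : n + 1 ≤ 2 * L) :
    2 * χ * |θ| + 4 * (L * ((n + 1 : ℕ) * η)) * |θ| ≤ 2 * χ * θ + 4 * (L * ((2 * L) * η)) * θ := by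
  rw [abs_of_nonneg hθ0]
  have hn1r : ((n + 1 : ℕ) : ℝ) ≤ 2 * (L : ℝ) := by exact_mod_cast hn2
  have hL0 : (0 : ℝ) ≤ L := Nat.cast_nonneg L
  have h : (L : ℝ) * ((n + 1 : ℕ) * η) ≤ L * ((2 * (L : ℝ)) * η) :=
    mul_le_mul_of_nonneg_left (mul_le_mul_of_nonneg_right hn1r hη0) hL0
  have h' := mul_le_mul_of_nonneg_right h hθ0
  linarith

/-- Monotonicity of the cost exponent in its two amplitudes and in the slice count (abstract form). [folklore] -/
theorem gaxis_exponent_mono {β η D Dg Ds Dgs N M P : ℝ} (hβ0 : 0 ≤ β) (hη0 : 0 ≤ η) (hD0 : 0 ≤ D) (hDg0 : 0 ≤ Dg)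
    (hDDs : D ≤ Ds) (hDgDgs : Dg ≤ Dgs) (hN0 : 0 ≤ N) (hNM : N ≤ M) (hP0 : 0 ≤ P)
    (hQ : β * (M * (P * (Ds ^ 2 + 2 * Ds * η)) + P * (Dgs ^ 2 + 2 * Dgs * η)) ≤ 1) :
    β * (N * (P * (D ^ 2 + 2 * D * η)) + P * (Dg ^ 2 + 2 * Dg * η)) ≤ 1 := by
  have hb1 : D ^ 2 + 2 * D * η ≤ Ds ^ 2 + 2 * Ds * η := GAxis.sq_add_mono hD0 hDDs hη0
  have hb2 : Dg ^ 2 + 2 * Dg * η ≤ Dgs ^ 2 + 2 * Dgs * η := GAxis.sq_add_mono hDg0 hDgDgs hη0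
  have hDs0 : 0 ≤ Ds ^ 2 + 2 * Ds * η := by have : 0 ≤ Ds := hD0.trans hDDs; positivity
  have h1 : N * (P * (D ^ 2 + 2 * D * η)) ≤ M * (P * (Ds ^ 2 + 2 * Ds * η)) :=
    mul_le_mul hNM (mul_le_mul_of_nonneg_left hb1 hP0) (by positivity) (hN0.trans hNM)
  have h2 : P * (Dg ^ 2 + 2 * Dg * η) ≤ P * (Dgs ^ 2 + 2 * Dgs * η) := mul_le_mul_of_nonneg_left hb2 hP0
  exact (mul_le_mul_of_nonneg_left (add_le_add h1 h2) hβ0).trans hQ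

/-- ★ The cost exponent of the shift on `n + 1 ≤ 2L` slices is at most `1` once its `2L`-slice majorant is. [folklore] -/
theorem gaxis_exponent_le_one {L : ℕ} [NeZero L] {β θ χ η : ℝ} {n : ℕ} (hβ0 : 0 ≤ β) (hθ0 : 0 ≤ θ) (hχ0 : 0 < χ) (hη0 : 0 ≤ η) (hn2 : n + 1 ≤ 2 * L)
    (hQ : β * ((2 * (L : ℝ)) * (3 * (L : ℝ) ^ 3 *
        ((θ * (2 * (L * (L * η)) / χ + L * (L * η) / χ + 2 * χ) + 2 * (L * (L * η)) * θ + 2 * ((2 * L) * η) * θ) ^ 2 +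
          2 * (θ * (2 * (L * (L * η)) / χ + L * (L * η) / χ + 2 * χ) + 2 * (L * (L * η)) * θ + 2 * ((2 * L) * η) * θ) * η)) +
      3 * (L : ℝ) ^ 3 * ((2 * χ * θ + 4 * (L * ((2 * L) * η)) * θ) ^ 2 + 2 * (2 * χ * θ + 4 * (L * ((2 * L) * η)) * θ) * η)) ≤ 1) :
    β * ((n + 1 : ℕ) * (Fintype.card (Plaquette 3 L) *
        ((|θ| * (L * ((n + 1 : ℕ) * η) / χ + L * (L * Real.sqrt (η ^ 2)) / χ + 2 * χ) + 2 * (L * (L * Real.sqrt (η ^ 2))) * |θ| + 2 * (n * η) * |θ|) ^ 2 +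
          2 * (|θ| * (L * ((n + 1 : ℕ) * η) / χ + L * (L * Real.sqrt (η ^ 2)) / χ + 2 * χ) + 2 * (L * (L * Real.sqrt (η ^ 2))) * |θ| + 2 * (n * η) * |θ|) * Real.sqrt (η ^ 2))) +
      Fintype.card (Edge 3 L) * ((2 * χ * |θ| + 4 * (L * ((n + 1 : ℕ) * η)) * |θ|) ^ 2 + 2 * (2 * χ * |θ| + 4 * (L * ((n + 1 : ℕ) * η)) * |θ|) * η)) ≤ 1 := by
  have hDDs := gaxisD_le (L := L) (n := n) hθ0 hχ0 hη0 hn2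
  have hDgDgs := gaxisDg_le (χ := χ) (L := L) (n := n) hθ0 hη0 hn2
  have hD0 : 0 ≤ |θ| * (L * ((n + 1 : ℕ) * η) / χ + L * (L * Real.sqrt (η ^ 2)) / χ + 2 * χ) + 2 * (L * (L * Real.sqrt (η ^ 2))) * |θ| +
      2 * (n * η) * |θ| := by positivity
  have hDg0 : 0 ≤ 2 * χ * |θ| + 4 * (L * ((n + 1 : ℕ) * η)) * |θ| := by positivity
  have hP3 : (Fintype.card (Plaquette 3 L) : ℝ) = 3 * (L : ℝ) ^ 3 := by
    have h := card_plaquette_add_card_edge_mul (L := L) (1 : ℝ)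
    have hE : (Fintype.card (Edge 3 L) : ℝ) = 3 * (L : ℝ) ^ 3 := by exact_mod_cast (FemtoTransferGap.card_edge_three L)
    rw [hE] at h; linarith
  have hE3 : (Fintype.card (Edge 3 L) : ℝ) = 3 * (L : ℝ) ^ 3 := by exact_mod_cast (FemtoTransferGap.card_edge_three L)
  have hn1r : ((n + 1 : ℕ) : ℝ) ≤ 2 * (L : ℝ) := by exact_mod_cast hn2
  rw [hP3, hE3, Real.sqrt_sq hη0]
  rw [Real.sqrt_sq hη0] at hDDs hD0
  exact gaxis_exponent_mono hβ0 hη0 hD0 hDg0 hDDs hDgDgs (by positivity) hn1r (by positivity) hQ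

/-- ★ Floor facts of the annulus: with `24L²η ≤ θ`, `3r ≤ θ ≤ 1`, `r > 0`, the inner radius `c₀ = (4/3)θ − 2r` and floor `σ = c₀/4` satisfy
`θ/6 ≤ σ`, `0 < σ ≤ 1` and `4L(Lη) ≤ c₀/2 − σ`. [folklore] -/
theorem annulus_floor {θ r η : ℝ} {L : ℕ} (hfl : 24 * ((L : ℝ) * (L * η)) ≤ θ) (h3r : 3 * r ≤ θ) (hθ1 : θ ≤ 1) (hr0 : 0 < r) :
    θ / 6 ≤ (4 / 3 * θ - 2 * r) / 4 ∧ 0 < (4 / 3 * θ - 2 * r) / 4 ∧ (4 / 3 * θ - 2 * r) / 4 ≤ 1 ∧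
      4 * ((L : ℝ) * (L * η)) ≤ (4 / 3 * θ - 2 * r) / 2 - (4 / 3 * θ - 2 * r) / 4 := by
  refine ⟨by linarith, by linarith, by linarith, by linarith⟩

/-- ★ Ratio facts of the annulus translates: from the master bound with `6/θ` in place of `1/σ` and `θ/6 ≤ σ`. [folklore] -/
theorem annulus_ratio {β η θ σ P : ℝ} {L : ℕ} (hP0 : 0 ≤ P) (hθ0 : 0 < θ) (hσ0 : 0 < σ) (hσθ : θ / 6 ≤ σ) (hβη : 1 ≤ β * η ^ 2)
    (hL1 : (1 : ℝ) ≤ L) (hM : 1000 * (L : ℝ) ^ 6 * (P * (6 / θ)) * (β * η ^ 2) ≤ 1) :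
    P ≤ σ / 2 ∧ 4 * (L : ℝ) ^ 4 * (P / σ) ≤ 1 / 2 ∧ 12 * β * (L : ℝ) ^ 4 * ((P * (2 * (L * η) / σ)) ^ 2 + 2 * (P * (2 * (L * η) / σ)) * η) ≤ 1 := by
  have hRle : P / σ ≤ P * (6 / θ) := by
    rw [div_eq_mul_inv]
    refine mul_le_mul_of_nonneg_left ?_ hP0
    rw [inv_eq_one_div, div_le_div_iff₀ hσ0 hθ0]; linarith
  have hR0 : 0 ≤ P / σ := div_nonneg hP0 hσ0.le
  have hMR : 1000 * (L : ℝ) ^ 6 * (P / σ) * (β * η ^ 2) ≤ 1 := by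
    have h0 : 0 ≤ 1000 * (L : ℝ) ^ 6 := by positivity
    have h1 : 0 ≤ β * η ^ 2 := by linarith
    exact (mul_le_mul_of_nonneg_right (mul_le_mul_of_nonneg_left hRle h0) h1).trans hM
  obtain ⟨hR1, hJ, hQ⟩ := shift_jac_cost_of_ratio (β := β) (L := L) hR0 hβη hL1 hMR
  refine ⟨?_, hJ, ?_⟩
  · have h := mul_le_mul_of_nonneg_right hR1 hσ0.le
    rw [div_mul_cancel₀ _ hσ0.ne'] at h
    linarith
  · have hrew : P * (2 * (L * η) / σ) = P / σ * (2 * (L * η)) := by ring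
    rw [hrew]; exact hQ

/-- ★ Bad-field bookkeeping: `(n+1)(E+E)P^{n+1} ≤ 4L·E·P^{2L}` for `n + 1 ≤ 2L`, `P ≥ 1`, `E ≥ 0`. [folklore] -/
theorem bad_step {E P : ℝ} {L n : ℕ} (hE0 : 0 ≤ E) (hP1 : 1 ≤ P) (hn2 : n + 1 ≤ 2 * L) :
    ((n : ℝ) + 1) * (E + E) * P ^ (n + 1) ≤ 4 * L * E * P ^ (2 * L) := by
  have hpow2 : P ^ (n + 1) ≤ P ^ (2 * L) := pow_le_pow_right₀ hP1 hn2
  have hn' : ((n : ℝ) + 1) ≤ 2 * L := by exact_mod_cast hn2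
  have hP0 : 0 ≤ P ^ (n + 1) := by positivity
  have h1 : ((n : ℝ) + 1) * (E + E) * P ^ (n + 1) ≤ (2 * L) * (E + E) * P ^ (n + 1) := by gcongr
  have h2 : (2 * (L : ℝ)) * (E + E) * P ^ (n + 1) ≤ (2 * L) * (E + E) * P ^ (2 * L) :=
    mul_le_mul_of_nonneg_left hpow2 (by positivity)
  nlinarith

/-- Final bookkeeping: `e·(x Z) + (x/2) Z = (e + 1/2) x Z`. [folklore] -/
theorem rate_bookkeeping {x y Z : ℝ} (hZ : 0 ≤ Z) (h : (Real.exp 1 + 1 / 2) * x ≤ y) :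
    Real.exp 1 * (x * Z) + x / 2 * Z ≤ y * Z := by
  have e : Real.exp 1 * (x * Z) + x / 2 * Z = ((Real.exp 1 + 1 / 2) * x) * Z := by ring
  rw [e]; exact mul_le_mul_of_nonneg_right h hZ

/-! ## §2 The periodic-sector core estimate -/

/-- ★ **The periodic-sector core estimate from the numeric inequalities.**  In the untwisted seam sector of a ring of `n + 1 ≤ 2L` slices (`n ≥ 1`),
with `r = β^{−2/5}`, `θ = β^{−13/40}`, `χ = β^{−1/4}`, `η = β^{−(1/2−1/40)}`, `K = ⌈64eβ^a⌉₊` and the inequalities of `OwnAxis.numericsCore_of_le` /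
`OwnAxis.numericsCoreQ_of_le`: `W₀(𝟙{polDist U₀ ≤ r}) ≤ β^{−a/2} · Z_phys(L, β, n+1)`. [cite: Luscher1983, §2] [cite: MontvayMunster1994, (3.145)] -/
theorem sectorWeight_core_le_of_numerics {L : ℕ} [NeZero L] {β a : ℝ} {n : ℕ} (hn1 : 1 ≤ n) (hn2 : n + 1 ≤ 2 * L)
    (h200 : 200 ≤ β)
    (hQ : β * ((2 * (L : ℝ)) * (3 * (L : ℝ) ^ 3 *
        ((β ^ (-(13 / 40 : ℝ)) * (2 * (L * (L * β ^ (-(1 / 2 - 1 / 40 : ℝ)))) / β ^ (-(1 / 4 : ℝ)) + L * (L * β ^ (-(1 / 2 - 1 / 40 : ℝ))) / β ^ (-(1 / 4 : ℝ)) +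
            2 * β ^ (-(1 / 4 : ℝ))) + 2 * (L * (L * β ^ (-(1 / 2 - 1 / 40 : ℝ)))) * β ^ (-(13 / 40 : ℝ)) + 2 * ((2 * L) * β ^ (-(1 / 2 - 1 / 40 : ℝ))) * β ^ (-(13 / 40 : ℝ))) ^ 2 +
          2 * (β ^ (-(13 / 40 : ℝ)) * (2 * (L * (L * β ^ (-(1 / 2 - 1 / 40 : ℝ)))) / β ^ (-(1 / 4 : ℝ)) + L * (L * β ^ (-(1 / 2 - 1 / 40 : ℝ))) / β ^ (-(1 / 4 : ℝ)) +
            2 * β ^ (-(1 / 4 : ℝ))) + 2 * (L * (L * β ^ (-(1 / 2 - 1 / 40 : ℝ)))) * β ^ (-(13 / 40 : ℝ)) + 2 * ((2 * L) * β ^ (-(1 / 2 - 1 / 40 : ℝ))) * β ^ (-(13 / 40 : ℝ))) *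
            β ^ (-(1 / 2 - 1 / 40 : ℝ)))) +
      3 * (L : ℝ) ^ 3 * ((2 * β ^ (-(1 / 4 : ℝ)) * β ^ (-(13 / 40 : ℝ)) + 4 * (L * ((2 * L) * β ^ (-(1 / 2 - 1 / 40 : ℝ)))) * β ^ (-(13 / 40 : ℝ))) ^ 2 +
        2 * (2 * β ^ (-(1 / 4 : ℝ)) * β ^ (-(13 / 40 : ℝ)) + 4 * (L * ((2 * L) * β ^ (-(1 / 2 - 1 / 40 : ℝ)))) * β ^ (-(13 / 40 : ℝ))) * β ^ (-(1 / 2 - 1 / 40 : ℝ)))) ≤ 1)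
    (hfl : 24 * ((L : ℝ) * (L * β ^ (-(1 / 2 - 1 / 40 : ℝ)))) ≤ β ^ (-(13 / 40 : ℝ)))
    (h3r : 3 * β ^ (-(2 / 5 : ℝ)) ≤ β ^ (-(13 / 40 : ℝ)))
    (hK1 : 1 ≤ ⌈64 * Real.exp 1 * β ^ a⌉₊)
    (hβη : 1 ≤ β * (β ^ (-(1 / 2 - 1 / 40 : ℝ))) ^ 2)
    (hM : 1000 * (L : ℝ) ^ 6 * ((((⌈64 * Real.exp 1 * β ^ a⌉₊ : ℕ) : ℝ) * (6 * β ^ (-(2 / 5 : ℝ)))) * (6 / β ^ (-(13 / 40 : ℝ)))) *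
        (β * (β ^ (-(1 / 2 - 1 / 40 : ℝ))) ^ 2) ≤ 1)
    (hG : 4 * (L : ℝ) * Real.exp (-(β * (β ^ (-(1 / 2 - 1 / 40 : ℝ))) ^ 2 / 2)) * (β ^ (315 * L ^ 3)) ^ (2 * L) ≤ β ^ (-a) / 2)
    (hKa : 32 * Real.exp 1 / ((⌈64 * Real.exp 1 * β ^ a⌉₊ : ℕ) : ℝ) ≤ β ^ (-a) / 2)
    (hrate : (Real.exp 1 + 1 / 2) * β ^ (-a) ≤ β ^ (-(a / 2))) :
    sectorWeight β n (fun _ => false) (fun Us _ => {U : GaugeConfig 3 L SU2 | polDist U ≤ β ^ (-(2 / 5 : ℝ))}.indicator (fun _ => (1 : ℝ)) (Us 0)) ≤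
      β ^ (-(a / 2)) * physTraceSucc L β n := by
  have hL1 : 1 ≤ L := NeZero.one_le
  have hL1r : (1 : ℝ) ≤ L := by exact_mod_cast hL1
  have hβ0 : 0 < β := lt_of_lt_of_le (by norm_num) h200
  have hβ1 : 1 ≤ β := le_trans (by norm_num) h200
  have hβ9 : 9 ≤ β := le_trans (by norm_num) h200
  -- parameters
  set r : ℝ := β ^ (-(2 / 5 : ℝ)) with hr
  set θ : ℝ := β ^ (-(13 / 40 : ℝ)) with hθ
  set χ : ℝ := β ^ (-(1 / 4 : ℝ)) with hχ
  set η : ℝ := β ^ (-(1 / 2 - 1 / 40 : ℝ)) with hη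
  set K : ℕ := ⌈64 * Real.exp 1 * β ^ a⌉₊ with hK
  have hr0 : 0 < r := Real.rpow_pos_of_pos hβ0 _
  have hθ0 : 0 < θ := Real.rpow_pos_of_pos hβ0 _
  have hχ0 : 0 < χ := Real.rpow_pos_of_pos hβ0 _
  have hη0 : 0 < η := Real.rpow_pos_of_pos hβ0 _
  have hθ1 : θ ≤ 1 := Real.rpow_le_one_of_one_le_of_nonpos hβ1 (by norm_num)
  -- (i) core ≤ e^Q · annulus + bad, with `Q ≤ 1`
  have hcore := GAxis.sectorWeight_core_le_exp_mul_annulus_add (L := L) hβ0.le n (s := η ^ 2) (t := η) (r := r) (θ := θ) (χ₀ := χ) (σ₁ := χ)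
    hη0.le hχ0 hχ0 hθ0.le hθ1 hr0
  have hC := Real.exp_le_exp.2 (gaxis_exponent_le_one (L := L) (n := n) hβ0.le hθ0.le hχ0 hη0.le hn2 hQ)
  -- (ii) the annulus is a cheap own-axis strip
  obtain ⟨hσθ, hσ0, hσ1, hflS⟩ := annulus_floor (L := L) hfl h3r hθ1 hr0
  have hθ' : 5 * r < 6 * r := by linarith
  obtain ⟨hKσ, hJ, hQS⟩ := annulus_ratio (β := β) (L := L) (P := (K : ℝ) * (6 * r)) (by positivity) hθ0 hσ0 hσθ hβη hL1r hM
  have hstrip := sectorWeight_stripGen_le_rpow_of_numerics (L := L) (z := fun _ => false) rfl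
    (f := fun _ : GaugeConfig 3 L SU2 => Real.sqrt (4 - 4 * |Real.cos θ|)) measurable_const (fun _ _ => rfl) hn1 hn2
    (a := a) (η := η) (w := r) (c₀ := 4 / 3 * θ - 2 * r) (σ := (4 / 3 * θ - 2 * r) / 4) (θ' := 6 * r) (K := K)
    h200 hη0 hr0 hθ' hσ0 hσ1 hflS hK1 hKσ hQS hJ hG hKa
  -- (iii) the bad fields
  have hZ0 : 0 ≤ physTraceSucc L β n :=
    le_trans (by positivity) (floor_le_physTraceSucc (L := L) hn1 hβ9 (floor_const_le.trans h200))
  have hbad := sectorWeight_indicator_compl_goodEvent_le_floor (L := L) hn1 hβ9 (floor_const_le.trans h200) (fun _ => false) (η ^ 2) hη0.le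
  have hτ : sectorWeight β n (fun _ => false) (fun Us g => (goodEvent (L := L) n (fun _ => false) (η ^ 2) η)ᶜ.indicator (fun _ => (1 : ℝ)) (g, Us)) ≤
      β ^ (-a) / 2 * physTraceSucc L β n := by
    refine hbad.trans ?_
    rw [badExponent_eq, show β / 2 * η ^ 2 = β * η ^ 2 / 2 by ring]
    have hstep := bad_step (L := L) (n := n) (E := Real.exp (-(β * η ^ 2 / 2))) (P := β ^ (315 * L ^ 3)) (Real.exp_pos _).le (one_le_pow₀ hβ1) hn2
    exact (mul_le_mul_of_nonneg_right hstep hZ0).trans (mul_le_mul_of_nonneg_right hG hZ0)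
  -- assemble
  have hS0 : 0 ≤ sectorWeight β n (fun _ => false) (fun Us _ =>
      {U : GaugeConfig 3 L SU2 | |polDist U - (fun _ : GaugeConfig 3 L SU2 => Real.sqrt (4 - 4 * |Real.cos θ|)) U| ≤ r ∧
        4 / 3 * θ - 2 * r < polDist U}.indicator (fun _ => (1 : ℝ)) (Us 0)) :=
    sectorWeight_nonneg β n _ fun Us _ => Set.indicator_nonneg (fun _ _ => zero_le_one) _
  exact (hcore.trans (add_le_add (mul_le_mul hC hstrip hS0 (Real.exp_pos _).le) hτ)).trans (rate_bookkeeping hZ0 hrate)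

/-- ★ **Crux K2 of route `FluxSectorLaplace`, proved**: periodic-sector toron core rarity with `γc = 2/5`, window exponent and rate `a = 1/800`,
`L₀ = 1`.  The Yang–Mills mass gap is NOT proved. [cite: Luscher1983, §2] [cite: tHooft1979] [cite: MontvayMunster1994, (3.145)] -/
theorem periodicCoreRaritySubQuartic_proof : Summit.QuantumFields.YangMills.Theses.FluxSectorLaplace.PeriodicCoreRaritySubQuartic := by
  obtain ⟨β₀, hnum⟩ := numericsCore_of_le (a := 1 / 400) (by norm_num) le_rfl
  obtain ⟨β₀', hnumQ⟩ := numericsCoreQ_of_le (a := 1 / 400) (by norm_num) le_rfl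
  refine ⟨2 / 5, le_rfl, 1 / 400 / 2, by norm_num, max (max β₀ β₀') 1, 1, fun β hβ L _ hL1 hLa => ?_⟩
  have hβ₀ : β₀ ≤ β := le_trans (le_trans (le_max_left _ _) (le_max_left _ _)) hβ
  have hβ₀' : β₀' ≤ β := le_trans (le_trans (le_max_right _ _) (le_max_left _ _)) hβ
  have hβ1 : (1 : ℝ) ≤ β := le_trans (le_max_right _ _) hβ
  have hLa' : (L : ℝ) ≤ β ^ (1 / 400 : ℝ) := hLa.trans (Real.rpow_le_rpow_of_exponent_le hβ1 (by norm_num))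
  obtain ⟨h200, -, hfl, h3r, hK1, hβη, hM, hG, hKa, hrate⟩ := hnum β hβ₀ L hL1 hLa'
  have hQ := hnumQ β hβ₀' L hL1 hLa'
  have hn1 : 1 ≤ 2 * L - 1 := by omega
  have hn2 : 2 * L - 1 + 1 ≤ 2 * L := by omega
  have hZ : physTrace L β (2 * L) = physTraceSucc L β (2 * L - 1) := rfl
  rw [hZ, show -(1 / 400 / 2 : ℝ) = -((1 / 400 : ℝ) / 2) by norm_num]
  exact sectorWeight_core_le_of_numerics (L := L) hn1 hn2 h200 hQ hfl h3r hK1 hβη hM hG hKa hrate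

end Summit.QuantumFields.YangMills.Theorems.FluxSectorLaplace

end
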